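import Summits.Ventures.Crystal3D.Theorems.StickyWulffConstantCoaxialWallLawSeamEndPools
import Summits.Ventures.Crystal3D.Theorems.StickyWulffConstantCoaxialWallLawSeamMotifDefs
import HarnessLib

/-!
# The MOTIF END-POOL input and its consumer for `stub_seamResidual` (crux `CoaxialWallLaw`, stmt-Ventures-19481; line `WallLedgerF`,
# skeleton 'CoaxialWallLawCertificates' v5; cf-p1 RULING (ccxx)(ii)–(iii))

HONEST FRAMING. Venture `Summits/Ventures/Crystal3D` (cell `crystal3d-full`); DEFINITIONS + one composition for the crux `CoaxialWallLaw`
(stmt-Ventures-19481, `route-Ventures-StickyWulffConstant`), registered line 'Certificates' v5, open stub `stub_seamResidual` (T5b).  Nothing is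
claimed about the three inputs; F-C1 not moved.
WHAT cf-p1 (ccxx) asked for: «type `TailResidue.MotifEndPools (Real.sqrt 6)` with the consumer `seamResidual_of_dichotomy_of_endPools :
TwinTwinDichotomy → MotifEndPools (Real.sqrt 6) → (KissingGap (5/2) → KissingClassification (5/2) → SeamResidual (2·√6) 3)`».
WHAT IS TYPED, and why there are THREE inputs, not two: `MotifEndPools p₀ k₀` is the certified local packing optimisation of (ccxx)(ii) in END-POOL form —
at an off-site payer within `2` of a Σ9 twin-reader pair (`Sigma9TwinPair` of `…SeamMotifDefs`, either order) or with a tetrahedra fan at an end ball within `1`,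
every ball `b` within `1` of the payer satisfies `p₀ · endMultA b ≤ pooledDef b` (or a deletion lands on-site).  `TwinTwinDichotomy` (`…SeamMotifDefs`) turns two
ADJACENT twin readers with distinct axes into such a pair.  What neither supplies is the step «a residual payer window (¬ MonoModuleAt, ¬ JammedOneAt, no
deletion on-site) CONTAINS two adjacent twin readers with distinct axes or a fan near the payer» — the READER-GRAPH REDUCTION of 19481-p1's memo
(SIGMA9-READER-PAIR-g17.md: adjacency lemmas landed for full/full, full/twin, twin/twin readers; connectivity of the reader graph, non-adjacent foreign
readers and narrow-reader junk OPEN).  It is typed here as the named input `ResidualMotifReduction k₀` so that the composition is an honest theorem: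
* `AdjacentTwinReadersAt`, `MotifAt` (Σ9 pair within `2` or fan at an end ball within `1`), `ResidualMotifReduction k₀`, `MotifEndPools p₀ k₀`;
* `motifAt_of_adjacentTwinReaders` — the dichotomy converts adjacent twin readers with distinct axes into `MotifAt`;
* `endPools_of_reduction` — `ResidualMotifReduction k₀ → TwinTwinDichotomy → MotifEndPools p₀ k₀ → EndPools p₀ k₀`;
* **`seamResidual_of_dichotomy_of_endPools`** — `ResidualMotifReduction 3 → TwinTwinDichotomy → MotifEndPools (√6) 3 →
  (KissingGap (5/2) → KissingClassification (5/2) → SeamResidual (2·√6) 3)` (via `seamResidual_of_endPools`, `…SeamEndPools`).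
WHAT THIS IS NOT: none of the three inputs is proved or claimed; the reduction is the crux-sized one (the structure theorem `exists_capping_of_not_monoModuleAt`
of `…MonoOfNonCapping` is the available handle: every placement has an off-module capping ball within `3`); F-C1 not moved.
-/

noncomputable section

namespace Summit.Ventures.Crystal3D.Theorems

namespace TailResidue

open Summit.Ventures.Crystal3D Finset
open scoped InnerProductSpace

/-- **ADJACENT TWIN READERS WITH DISTINCT AXES near the payer `z`**: two touching balls within `2` of `z`, each a twin reader, whose twin normals are
neither equal nor opposite (the pre-dichotomy shape of a Σ9 junction). -/
def AdjacentTwinReadersAt (X : Finset (EuclideanSpace ℝ (Fin 3))) (z : EuclideanSpace ℝ (Fin 3)) : Prop :=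
  ∃ q₁ ∈ X, ∃ q₂ ∈ X, dist z q₁ ≤ 2 ∧ dist z q₂ ≤ 2 ∧ dist q₁ q₂ = 1 ∧
    ∃ (G₁ G₂ : EuclideanSpace ℝ (Fin 3) ≃ₗᵢ[ℝ] EuclideanSpace ℝ (Fin 3)) (m₁ m₂ : EuclideanSpace ℝ (Fin 3)),
      IsTwinReading X G₁ m₁ q₁ ∧ IsTwinReading X G₂ m₂ q₂ ∧ m₂ ≠ m₁ ∧ m₂ ≠ -m₁

/-- **A SEAM MOTIF AT THE PAYER `z`**: a Σ9 twin-reader pair (either presentation, either order) with both readers within `2` of `z`, or a tetrahedra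
fan around an edge at a ball within `1` of `z`. -/
def MotifAt (X : Finset (EuclideanSpace ℝ (Fin 3))) (z : EuclideanSpace ℝ (Fin 3)) : Prop :=
  (∃ q₁ ∈ X, ∃ q₂ ∈ X, dist z q₁ ≤ 2 ∧ dist z q₂ ≤ 2 ∧ Sigma9TwinPair X q₁ q₂) ∨
    ∃ b p t₁ t₂ t₃ t₄ : EuclideanSpace ℝ (Fin 3), dist z b ≤ 1 ∧ TetraFanAt X b p t₁ t₂ t₃ t₄

open scoped Classical in
/-- **THE READER-GRAPH REDUCTION (named input, OPEN)**: at a residual payer window — `1`-separated, `deg z ≤ 11`, off-site for 𝒰_cx, NOT mono-module for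
the frame `L`, `k₀ < deg z`, not of the jammed-one shape — a deletion of inessential balls lands on-site, or two adjacent twin readers with distinct
axes sit within `2` of the payer, or a seam motif is already present.  (19481-p1's reader-lattice-graph programme; adjacency lemmas landed, connectivity /
foreign non-adjacent readers / narrow junk open.) -/
def ResidualMotifReduction (k₀ : ℕ) : Prop :=
  ∀ L : EuclideanSpace ℝ (Fin 3) ≃ₗᵢ[ℝ] EuclideanSpace ℝ (Fin 3),
  ∀ X : Finset (EuclideanSpace ℝ (Fin 3)), (∀ p ∈ X, ∀ q ∈ X, p ≠ q → 1 ≤ dist p q) →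
  ∀ z ∈ X, (X.filter fun q => dist z q = 1).card ≤ 11 → ¬ OnSiteAt coaxialModuleUniverse X z → ¬ MonoModuleAt L X z →
    k₀ < (X.filter fun q => dist z q = 1).card → ¬ JammedOneAt X z →
    HasDeletionOnSite X z ∨ AdjacentTwinReadersAt X z ∨ MotifAt X z

open scoped Classical in
/-- **MOTIF END POOLS at ratio `p₀` (named input; the certified local packing optimisation of cf-p1 (ccxx)(ii), owner cf-p2)**: at an off-site payer
`z` (`1`-separated, `deg z ≤ 11`, not mono-module for `L`, `k₀ < deg z`, not jammed-one) carrying a seam motif (`MotifAt`), a deletion lands on-site or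
EVERY ball `b` within `1` of `z` has
`p₀ · endMultA b ≤ pooledDef b` for the joint basal systems of `L` (version `v2`, clause (A)).  Crystalline completions measured by 19481-p1 g17:
minimum ratio `7/2` (first-generation junction) and `3` (second-generation junction) against `p₀ = √6 ≈ 2.449`. -/
def MotifEndPools (p₀ : ℝ) (k₀ : ℕ) : Prop :=
  ∀ L : EuclideanSpace ℝ (Fin 3) ≃ₗᵢ[ℝ] EuclideanSpace ℝ (Fin 3),
  ∀ X : Finset (EuclideanSpace ℝ (Fin 3)), (∀ p ∈ X, ∀ q ∈ X, p ≠ q → 1 ≤ dist p q) →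
  ∀ z ∈ X, (X.filter fun q => dist z q = 1).card ≤ 11 → ¬ OnSiteAt coaxialModuleUniverse X z → ¬ MonoModuleAt L X z →
    k₀ < (X.filter fun q => dist z q = 1).card → ¬ JammedOneAt X z → MotifAt X z →
    HasDeletionOnSite X z ∨
      ∀ b ∈ X, dist z b ≤ 1 →
        p₀ * (endMultA X WordVersion.v2 (basalSystem L) (basalSystem (((ℝ ∙ EuclideanSpace.single (2 : Fin 3) (1 : ℝ)).reflection).trans L)) b : ℝ) ≤
          pooledDef X b

/-- `MotifEndPools` is monotone: a larger ratio and a smaller degree threshold are stronger. -/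
theorem motifEndPools_mono {p₀ p₁ : ℝ} {k₀ k₁ : ℕ} (h : MotifEndPools p₁ k₀) (hp : p₀ ≤ p₁) (hk : k₀ ≤ k₁) : MotifEndPools p₀ k₁ := by
  intro L X hX z hz hdeg hoff hM hk' hJ hmot
  rcases h L X hX z hz hdeg hoff hM (lt_of_le_of_lt hk hk') hJ hmot with hdel | hpool
  · exact Or.inl hdel
  · refine Or.inr fun b hb hzb => le_trans ?_ (hpool b hb hzb)
    exact mul_le_mul_of_nonneg_right hp (Nat.cast_nonneg _)

/-- **The dichotomy converts adjacent twin readers with distinct axes into a seam motif** (a Σ9 pair in one of the two orders). -/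
theorem motifAt_of_adjacentTwinReaders (hdich : TwinTwinDichotomy) {X : Finset (EuclideanSpace ℝ (Fin 3))}
    (hX : ∀ p ∈ X, ∀ q ∈ X, p ≠ q → 1 ≤ dist p q) {z : EuclideanSpace ℝ (Fin 3)} (h : AdjacentTwinReadersAt X z) : MotifAt X z := by
  obtain ⟨q₁, hq₁, q₂, hq₂, hz₁, hz₂, hd, G₁, G₂, m₁, m₂, hr₁, hr₂, hne, hne'⟩ := h
  rcases hdich X hX G₁ G₂ m₁ m₂ q₁ q₂ hq₁ hq₂ hr₁ hr₂ hd with hax | h₁₂ | h₂₁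
  · exact absurd hax (not_or.2 ⟨hne, hne'⟩)
  · exact Or.inl ⟨q₁, hq₁, q₂, hq₂, hz₁, hz₂, h₁₂⟩
  · exact Or.inl ⟨q₂, hq₂, q₁, hq₁, hz₂, hz₁, h₂₁⟩

/-- **Reduction + dichotomy + motif pools ⇒ end pools.** -/
theorem endPools_of_reduction {p₀ : ℝ} {k₀ : ℕ} (hred : ResidualMotifReduction k₀) (hdich : TwinTwinDichotomy) (hmot : MotifEndPools p₀ k₀) :
    EndPools p₀ k₀ := by
  intro L X hX z hz hdeg hoff hM hk hJ
  rcases hred L X hX z hz hdeg hoff hM hk hJ with hdel | hadj | hmotif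
  · exact Or.inl hdel
  · exact hmot L X hX z hz hdeg hoff hM hk hJ (motifAt_of_adjacentTwinReaders hdich hX hadj)
  · exact hmot L X hX z hz hdeg hoff hM hk hJ hmotif

/-- **THE CONSUMER of cf-p1 (ccxx)(iii)**: the reader-graph reduction, the twin–twin dichotomy and the motif end pools at ratio `√6` settle
`SeamResidual (2·√6) 3` (the kissing facts of the stub's signature are not needed by this composition). -/
theorem seamResidual_of_dichotomy_of_endPools (hred : ResidualMotifReduction 3) (hdich : TwinTwinDichotomy) (hmot : MotifEndPools (Real.sqrt 6) 3) :
    KissingGap (5 / 2) → KissingClassification (5 / 2) → SeamResidual (2 * Real.sqrt 6) 3 :=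
  fun _ _ => seamResidual_of_endPools (endPools_of_reduction hred hdich hmot) le_rfl

end TailResidue

end Summit.Ventures.Crystal3D.Theorems

end
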